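/-
Copyright: H21 programme, solo seat `solo-RiemannHypothesis-informed` (session 6).
-/
import Mathlib
import Literature.Analysis.Complex.TuranSecondMainTheorem

/-!
# Turán visibility of finite exponential sums (solo-informed, T39a)

The power-sum input of the "price of a companion" theorem (T39).  For a finite family of complex
exponents `λ_j` with non-negative weights `b_j` and a member `j₀` of MAXIMAL REAL PART, Turán's
second main theorem (tree: `Literature.Analysis.Complex.PowerSum.exists_powerSum_ge_max`, applied
to the nodes `z_j = e^{λ_j/n}` and the powers `ν ∈ [D+1, D+n]`, `D = ⌊nτ₀⌋`) gives a point `τ` of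
ANY unit interval `[τ₀, τ₀+1]` (`τ₀ ≥ 0`) at which the exponential sum is not small:

  `‖∑_j b_j e^{λ_j τ}‖ ≥ b_{j₀} · c(n, τ₀) · e^{Re λ_{j₀} τ}`,  `c(n, τ₀) = e^{-n} (250(τ₀+1))^{-(n+1)}`

(`exists_norm_expSum_ge`), together with the robust form allowing multiplicative weight errors
`w_j`, `‖w_j − 1‖ ≤ ε` (`exists_norm_expSum_ge_of_weights`).  The loss `c(n, τ₀)` is polynomial in
`τ₀` of degree `n + 1`: this is the "price" `(n+1) log(250(τ₀+1))` of `n` exponents.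
-/

open Finset Complex

namespace Summit.RiemannHypothesis.RiemannHypothesis.Theorems

/-- Turán's visibility constant `c(n, τ₀) = e^{-n} · (250(τ₀+1))^{-(n+1)}`. -/
noncomputable def turanConst (n : ℕ) (τ₀ : ℝ) : ℝ :=
  Real.exp (-(n : ℝ)) * ((250 * (τ₀ + 1)) ^ (n + 1))⁻¹

/-- `0 < c(n, τ₀)` for `τ₀ ≥ 0`. -/
theorem turanConst_pos (n : ℕ) {τ₀ : ℝ} (hτ₀ : 0 ≤ τ₀) : 0 < turanConst n τ₀ := by
  unfold turanConst; positivity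

/-- `c(n, τ₀) ≤ 1`. -/
theorem turanConst_le_one (n : ℕ) {τ₀ : ℝ} (hτ₀ : 0 ≤ τ₀) : turanConst n τ₀ ≤ 1 := by
  unfold turanConst
  have h1 : Real.exp (-(n : ℝ)) ≤ 1 := Real.exp_le_one_iff.mpr (by simp)
  have h2 : (1 : ℝ) ≤ (250 * (τ₀ + 1)) ^ (n + 1) := one_le_pow₀ (by linarith)
  have h3 : ((250 * (τ₀ + 1)) ^ (n + 1))⁻¹ ≤ 1 := inv_le_one_of_one_le₀ h2
  have h4 : 0 ≤ ((250 * (τ₀ + 1)) ^ (n + 1))⁻¹ := by positivity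
  calc Real.exp (-(n : ℝ)) * ((250 * (τ₀ + 1)) ^ (n + 1))⁻¹ ≤ 1 * 1 :=
        mul_le_mul h1 h3 h4 zero_le_one
    _ = 1 := one_mul 1

/-- `c(n, τ₀)` is antitone in `n` (for `τ₀ ≥ 0`). -/
theorem turanConst_anti {m n : ℕ} (hmn : m ≤ n) {τ₀ : ℝ} (hτ₀ : 0 ≤ τ₀) :
    turanConst n τ₀ ≤ turanConst m τ₀ := by
  unfold turanConst
  have hb : (1 : ℝ) ≤ 250 * (τ₀ + 1) := by linarith
  have h1 : Real.exp (-(n : ℝ)) ≤ Real.exp (-(m : ℝ)) :=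
    Real.exp_le_exp.mpr (by simpa using (Nat.cast_le.mpr hmn : (m : ℝ) ≤ n))
  have h2 : ((250 * (τ₀ + 1)) ^ (n + 1))⁻¹ ≤ ((250 * (τ₀ + 1)) ^ (m + 1))⁻¹ := by
    rw [inv_le_inv₀ (by positivity) (by positivity)]
    exact pow_le_pow_right₀ hb (by omega)
  exact mul_le_mul h1 h2 (by positivity) (by positivity)

/-- **Turán visibility of exponential sums (T39a).**  Let `s` be a finite index set, `λ : ι → ℂ`,
`b_j ≥ 0` on `s`, and `j₀ ∈ s` with `Re λ_j ≤ Re λ_{j₀}` for all `j ∈ s`.  For every `τ₀ ≥ 0` there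
is `τ ∈ [τ₀, τ₀ + 1]` with `b_{j₀} · c(#s, τ₀) · e^{Re λ_{j₀} τ} ≤ ‖∑_{j ∈ s} b_j e^{λ_j τ}‖`. -/
theorem exists_norm_expSum_ge {ι : Type*} (s : Finset ι) (lam : ι → ℂ) (b : ι → ℝ)
    (hb : ∀ j ∈ s, 0 ≤ b j) {j₀ : ι} (hj₀ : j₀ ∈ s) (hmax : ∀ j ∈ s, (lam j).re ≤ (lam j₀).re)
    {τ₀ : ℝ} (hτ₀ : 0 ≤ τ₀) :
    ∃ τ ∈ Set.Icc τ₀ (τ₀ + 1),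
      b j₀ * turanConst s.card τ₀ * Real.exp ((lam j₀).re * τ) ≤
        ‖∑ j ∈ s, (b j : ℂ) * cexp (lam j * τ)‖ := by
  classical
  set n : ℕ := s.card with hn_def
  have hn1 : 1 ≤ n := Finset.card_pos.mpr ⟨j₀, hj₀⟩
  have hn0 : (0 : ℝ) < n := by exact_mod_cast hn1
  set δ : ℝ := (n : ℝ)⁻¹ with hδ_def
  have hδ0 : 0 < δ := inv_pos.mpr hn0
  set z : ι → ℂ := fun j ↦ cexp (lam j * (δ : ℂ)) with hz_def
  have hzre : ∀ j, (lam j * (δ : ℂ)).re = (lam j).re * δ := by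
    intro j; simp [Complex.mul_re]
  have hznorm : ∀ j, ‖z j‖ = Real.exp ((lam j).re * δ) := by
    intro j; rw [hz_def]; dsimp only; rw [Complex.norm_exp, hzre]
  have hzmax : ∀ j ∈ s, ‖z j‖ ≤ ‖z j₀‖ := by
    intro j hj
    rw [hznorm, hznorm]
    exact Real.exp_le_exp.mpr (mul_le_mul_of_nonneg_right (hmax j hj) hδ0.le)
  have hz0 : z j₀ ≠ 0 := Complex.exp_ne_zero _
  set D : ℕ := ⌊(n : ℝ) * τ₀⌋₊ with hD_def
  have hDle : (D : ℝ) ≤ n * τ₀ := Nat.floor_le (by positivity)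
  have hDlt : (n : ℝ) * τ₀ < D + 1 := Nat.lt_floor_add_one _
  obtain ⟨ν, hν, hT⟩ :=
    Literature.Analysis.Complex.PowerSum.exists_powerSum_ge_max s z b hb hj₀ hzmax hz0 D
  rw [Finset.mem_Icc] at hν
  obtain ⟨hν1, hν2⟩ := hν
  have hν1' : (D : ℝ) + 1 ≤ ν := by exact_mod_cast hν1
  have hν2' : (ν : ℝ) ≤ D + n := by exact_mod_cast hν2
  set τ : ℝ := ν * δ with hτ_def
  refine ⟨τ, ⟨?_, ?_⟩, ?_⟩
  · -- `τ₀ ≤ τ`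
    rw [hτ_def, hδ_def, ← div_eq_mul_inv, le_div_iff₀ hn0]
    linarith
  · -- `τ ≤ τ₀ + 1`
    rw [hτ_def, hδ_def, ← div_eq_mul_inv, div_le_iff₀ hn0]
    nlinarith
  · -- the bound
    have hpow : ∀ j, z j ^ ν = cexp (lam j * (τ : ℂ)) := by
      intro j
      rw [hz_def]; dsimp only
      rw [← Complex.exp_nat_mul, hτ_def]
      push_cast; ring_nf
    have hnormpow : ‖z j₀‖ ^ ν = Real.exp ((lam j₀).re * τ) := by
      rw [hznorm, ← Real.exp_nat_mul, hτ_def]; ring_nf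
    have hsum : ∑ j ∈ s, (b j : ℂ) * z j ^ ν = ∑ j ∈ s, (b j : ℂ) * cexp (lam j * (τ : ℂ)) :=
      Finset.sum_congr rfl fun j _ ↦ by rw [hpow]
    rw [hsum, hnormpow] at hT
    refine le_trans ?_ hT
    have hexp : 0 ≤ Real.exp ((lam j₀).re * τ) := (Real.exp_pos _).le
    refine mul_le_mul_of_nonneg_right (mul_le_mul_of_nonneg_left ?_ (hb j₀ hj₀)) hexp
    -- `turanConst n τ₀ ≤ e^{-n} (n/(250(D+n)))^{n+1}`
    unfold turanConst
    refine mul_le_mul_of_nonneg_left ?_ (Real.exp_pos _).le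
    have hDn : (D : ℝ) + n ≤ n * (τ₀ + 1) := by linarith
    have hDn0 : (0 : ℝ) < D + n := by positivity
    have hfrac : (250 * (τ₀ + 1))⁻¹ ≤ (n : ℝ) / (250 * (D + n)) := by
      rw [inv_eq_one_div, div_le_div_iff₀ (by positivity) (by positivity)]
      nlinarith
    rw [← inv_pow]
    exact pow_le_pow_left₀ (by positivity) hfrac _

/-- **Robust Turán visibility (T39a′).**  As `exists_norm_expSum_ge`, with complex weight factors
`w_j`, `‖w_j − 1‖ ≤ ε` on `s`: there is `τ ∈ [τ₀, τ₀+1]` with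
`(b_{j₀} c(#s, τ₀) − ε ∑_j b_j) · e^{Re λ_{j₀} τ} ≤ ‖∑_j b_j w_j e^{λ_j τ}‖`. -/
theorem exists_norm_expSum_ge_of_weights {ι : Type*} (s : Finset ι) (lam : ι → ℂ) (b : ι → ℝ)
    (hb : ∀ j ∈ s, 0 ≤ b j) {j₀ : ι} (hj₀ : j₀ ∈ s) (hmax : ∀ j ∈ s, (lam j).re ≤ (lam j₀).re)
    {τ₀ : ℝ} (hτ₀ : 0 ≤ τ₀) (w : ι → ℂ) {ε : ℝ} (hw : ∀ j ∈ s, ‖w j - 1‖ ≤ ε) :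
    ∃ τ ∈ Set.Icc τ₀ (τ₀ + 1),
      (b j₀ * turanConst s.card τ₀ - ε * ∑ j ∈ s, b j) * Real.exp ((lam j₀).re * τ) ≤
        ‖∑ j ∈ s, (b j : ℂ) * w j * cexp (lam j * τ)‖ := by
  obtain ⟨τ, hτ, hT⟩ := exists_norm_expSum_ge s lam b hb hj₀ hmax hτ₀
  refine ⟨τ, hτ, ?_⟩
  have hτ0 : 0 ≤ τ := hτ₀.trans hτ.1
  set E : ℝ := Real.exp ((lam j₀).re * τ) with hE
  -- the perturbation
  have hsplit : ∑ j ∈ s, (b j : ℂ) * w j * cexp (lam j * τ) =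
      ∑ j ∈ s, (b j : ℂ) * cexp (lam j * τ) +
        ∑ j ∈ s, (b j : ℂ) * (w j - 1) * cexp (lam j * τ) := by
    rw [← Finset.sum_add_distrib]
    exact Finset.sum_congr rfl fun j _ ↦ by ring
  have hpert : ‖∑ j ∈ s, (b j : ℂ) * (w j - 1) * cexp (lam j * τ)‖ ≤ ε * (∑ j ∈ s, b j) * E := by
    refine (norm_sum_le _ _).trans ?_
    rw [Finset.mul_sum, Finset.sum_mul]
    refine Finset.sum_le_sum fun j hj ↦ ?_
    rw [norm_mul, norm_mul, Complex.norm_real, Real.norm_of_nonneg (hb j hj), Complex.norm_exp]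
    have hre : (lam j * (τ : ℂ)).re = (lam j).re * τ := by simp [Complex.mul_re]
    rw [hre]
    have h1 : Real.exp ((lam j).re * τ) ≤ E :=
      Real.exp_le_exp.mpr (mul_le_mul_of_nonneg_right (hmax j hj) hτ0)
    have h2 : ‖w j - 1‖ ≤ ε := hw j hj
    have hε : 0 ≤ ε := (norm_nonneg _).trans h2
    calc b j * ‖w j - 1‖ * Real.exp ((lam j).re * τ) ≤ b j * ε * Real.exp ((lam j).re * τ) :=
          mul_le_mul_of_nonneg_right (mul_le_mul_of_nonneg_left h2 (hb j hj)) (Real.exp_pos _).le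
      _ ≤ b j * ε * E := mul_le_mul_of_nonneg_left h1 (mul_nonneg (hb j hj) hε)
      _ = ε * b j * E := by ring
  rw [hsplit]
  have htri := norm_add_le (∑ j ∈ s, (b j : ℂ) * cexp (lam j * τ) +
      ∑ j ∈ s, (b j : ℂ) * (w j - 1) * cexp (lam j * τ))
    (-(∑ j ∈ s, (b j : ℂ) * (w j - 1) * cexp (lam j * τ)))
  rw [add_neg_cancel_right, norm_neg] at htri
  have : b j₀ * turanConst s.card τ₀ * E - ε * (∑ j ∈ s, b j) * E ≤
      ‖∑ j ∈ s, (b j : ℂ) * cexp (lam j * τ) +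
        ∑ j ∈ s, (b j : ℂ) * (w j - 1) * cexp (lam j * τ)‖ := by linarith
  linarith [this]

end Summit.RiemannHypothesis.RiemannHypothesis.Theorems
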